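import Mathlib.Analysis.Normed.Group.Ultra
import Mathlib.Analysis.Normed.Field.Ultra
import Mathlib.Analysis.SpecificLimits.Normed
import Mathlib.Topology.Algebra.InfiniteSum.NatInt
import Mathlib.Topology.Algebra.InfiniteSum.Real
import Mathlib.Tactic.LinearCombination
import Mathlib.Tactic.Ring
import HarnessLib

/-!
# Ultrametric Newton interpolation with confluent nodes (divided differences of power series)

Everything in this file is **proved**; the only definitions are bookkeeping (`WtBdd`, the
divided-difference operator `dd` on coefficient sequences, its iterate `ddList` along a list of
nodes, and the Newton sum `newtonSum`).

Setting: `K` a complete non-archimedean (ultrametric) normed field (e.g. `ℚ_p`, `ℂ_p`), a power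
series `G_b(z) = ∑ bₙ zⁿ` whose coefficients satisfy the WEIGHTED bound `‖bₙ‖ ρⁿ ≤ B` for a real
radius `ρ > 0` (so `G_b` converges on `‖z‖ < ρ`; `ρ` need not be the norm of an element of `K` —
for the `p`-adic exponential `exp(z L)` with `‖L‖ ≤ p⁻¹` one has `ρ = p^{(p-2)/(p-1)} ∉ p^ℤ`), and
points in a closed disc `‖z‖ ≤ r` with `r < ρ`.

* `dd a b` — the coefficient sequence of the divided difference `z ↦ (G_b(z) − G_b(a))/(z − a)`
  (`hₙ = ∑_k b_{n+1+k} aᵏ`); it satisfies the weighted bound with `B/ρ` (`wtBdd_dd`), the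
  **division identity** `G_b(z) = G_b(a) + (z − a) G_{dd a b}(z)` (`tsum_eq_add_sub_mul_tsum_dd`),
  and `dd a (dd c b) = dd c (dd a b)` (`dd_comm`, Fubini for the absolutely convergent double sum).
* `ddList xs b` — iterated divided differences along a list of nodes (confluent nodes allowed),
  order-independent (`ddList_perm`); `newtonSum` and **Newton's formula with remainder**
  `G_b(z) = ∑ᵢ G_{b⁽ⁱ⁾}(xᵢ) ∏_{j<i} (z − xⱼ) + G_{b⁽ᴺ⁾}(z) ∏_{j<N} (z − xⱼ)` (`tsum_eq_newtonSum_add`).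

The companion file `PadicSmallJetsSchwarz.lean` deduces Taylor's formula, the uniqueness of
Taylor coefficients, and the ultrametric Schwarz lemma with multiplicities and APPROXIMATELY
vanishing jets — the extrapolation device of the `p`-adic theory of linear forms in logarithms
(Yu, *Linear forms in p-adic logarithms II*, Compositio Math. 74 (1990), §3, "p-adic normal
functions"). The unit-disc, exact-zero, simple-multiplicity case is the tree's
`Literature.NumberTheory.Transcendental.norm_tsum_mul_pow_le_mul_prod` (`PadicSchwarzLemma.lean`),
whose synthetic-division argument this file generalises.

## References
* A. M. Robert, *A Course in `p`-adic Analysis*, GTM 198 (2000), Ch. 6 §2 (zeros of power series).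
* Kunrui Yu, *Linear forms in p-adic logarithms II*, Compositio Math. 74 (1990), 15–113, §3.
-/

noncomputable section

open Filter Topology IsUltrametricDist Finset

namespace Literature.NumberTheory.Transcendental

namespace PadicNewton

variable {K : Type*} [NontriviallyNormedField K] [IsUltrametricDist K] [CompleteSpace K]

/-! ### Weighted coefficient bounds -/

/-- Weighted bound on a coefficient sequence: `‖bₙ‖ ρⁿ ≤ B` for all `n` (the series `∑ bₙ zⁿ`
then converges on `‖z‖ < ρ` and is bounded by `B` there).
[cite: Yu1990, §1 (normal series and functions, after Mahler)] -/
def WtBdd (ρ B : ℝ) (b : ℕ → K) : Prop :=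
  ∀ n, ‖b n‖ * ρ ^ n ≤ B

omit [IsUltrametricDist K] [CompleteSpace K] in
/-- `B ≥ 0` under a weighted bound.
[cite: Yu1990, §1 (normal series and functions, after Mahler)] -/
theorem WtBdd.nonneg {ρ B : ℝ} {b : ℕ → K} (hb : WtBdd ρ B b) : 0 ≤ B := by
  have := hb 0
  simp only [pow_zero, mul_one] at this
  exact (norm_nonneg _).trans this

omit [IsUltrametricDist K] [CompleteSpace K] in
/-- Term bound: `‖bₙ zⁿ‖ ≤ B (r/ρ)ⁿ` for `‖z‖ ≤ r`.
[cite: Yu1990, §1 (normal series and functions, after Mahler)] -/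
theorem WtBdd.norm_term_le {ρ B r : ℝ} {b : ℕ → K} (hb : WtBdd ρ B b) (hρ : 0 < ρ) {z : K}
    (hz : ‖z‖ ≤ r) (n : ℕ) : ‖b n * z ^ n‖ ≤ B * (r / ρ) ^ n := by
  have hr : 0 ≤ r := (norm_nonneg _).trans hz
  rw [norm_mul, norm_pow, div_pow, ← mul_div_assoc, le_div_iff₀ (pow_pos hρ n)]
  calc ‖b n‖ * ‖z‖ ^ n * ρ ^ n = (‖b n‖ * ρ ^ n) * ‖z‖ ^ n := by ring
    _ ≤ B * r ^ n := mul_le_mul (hb n) (pow_le_pow_left₀ (norm_nonneg _) hz n)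
        (pow_nonneg (norm_nonneg _) _) hb.nonneg

omit [IsUltrametricDist K] [CompleteSpace K] in
/-- Term bound without the decay: `‖bₙ zⁿ‖ ≤ B` for `‖z‖ ≤ r ≤ ρ`.
[cite: Yu1990, §1 (normal series and functions, after Mahler)] -/
theorem WtBdd.norm_term_le' {ρ B r : ℝ} {b : ℕ → K} (hb : WtBdd ρ B b) (hρ : 0 < ρ) (hr : r ≤ ρ)
    {z : K} (hz : ‖z‖ ≤ r) (n : ℕ) : ‖b n * z ^ n‖ ≤ B := by
  have hr0 : 0 ≤ r := (norm_nonneg _).trans hz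
  refine (hb.norm_term_le hρ hz n).trans ?_
  exact mul_le_of_le_one_right hb.nonneg (pow_le_one₀ (div_nonneg hr0 hρ.le)
    ((div_le_one hρ).mpr hr))

omit [IsUltrametricDist K] in
/-- Summability of `∑ bₙ zⁿ` for `‖z‖ ≤ r < ρ`.
[cite: Yu1990, §1 (normal series and functions, after Mahler)] -/
theorem WtBdd.summable {ρ B r : ℝ} {b : ℕ → K} (hb : WtBdd ρ B b) (hρ : 0 < ρ) (hr : r < ρ)
    {z : K} (hz : ‖z‖ ≤ r) : Summable fun n ↦ b n * z ^ n := by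
  have hr0 : 0 ≤ r := (norm_nonneg _).trans hz
  refine Summable.of_norm_bounded ((summable_geometric_of_lt_one (div_nonneg hr0 hρ.le)
    ((div_lt_one hρ).mpr hr)).mul_left B) fun n ↦ hb.norm_term_le hρ hz n

omit [CompleteSpace K] in
/-- Ultrametric maximum principle, trivial half: `‖∑ bₙ zⁿ‖ ≤ B` for `‖z‖ ≤ r ≤ ρ`.
[cite: Yu1990, §1 (normal series and functions, after Mahler)] -/
theorem WtBdd.norm_tsum_le {ρ B r : ℝ} {b : ℕ → K} (hb : WtBdd ρ B b) (hρ : 0 < ρ) (hr : r ≤ ρ)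
    {z : K} (hz : ‖z‖ ≤ r) : ‖∑' n, b n * z ^ n‖ ≤ B :=
  norm_tsum_le_of_forall_le_of_nonneg hb.nonneg fun n ↦ hb.norm_term_le' hρ hr hz n

omit [IsUltrametricDist K] [CompleteSpace K] in
/-- Monotonicity of the weighted bound in `B`.
[cite: Yu1990, §1 (normal series and functions, after Mahler)] -/
theorem WtBdd.mono {ρ B B' : ℝ} {b : ℕ → K} (hb : WtBdd ρ B b) (h : B ≤ B') : WtBdd ρ B' b :=
  fun n ↦ (hb n).trans h

/-! ### The divided-difference operator on coefficient sequences -/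

/-- The coefficient sequence of the divided difference `(G_b(z) − G_b(a))/(z − a)`:
`(dd a b)ₙ = ∑_k b_{n+1+k} aᵏ`.
[cite: Robert2000PadicAnalysis, Ch. 6 §2 (zeros of power series; division by z − a)] -/
def dd (a : K) (b : ℕ → K) : ℕ → K := fun n ↦ ∑' k, b (n + 1 + k) * a ^ k

omit [IsUltrametricDist K] [CompleteSpace K] in
/-- Shifted weighted bound: the sequence `k ↦ b_{m+k}` satisfies the weighted bound with
`B / ρᵐ`. [cite: Yu1990, §1 (normal series and functions, after Mahler)] -/
theorem WtBdd.shift {ρ B : ℝ} {b : ℕ → K} (hb : WtBdd ρ B b) (hρ : 0 < ρ) (m : ℕ) :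
    WtBdd ρ (B / ρ ^ m) (fun k ↦ b (m + k)) := by
  intro k
  rw [le_div_iff₀ (pow_pos hρ m)]
  calc ‖b (m + k)‖ * ρ ^ k * ρ ^ m = ‖b (m + k)‖ * ρ ^ (m + k) := by rw [pow_add]; ring
    _ ≤ B := hb (m + k)

omit [CompleteSpace K] in
/-- The divided difference again satisfies a weighted bound, with `B/ρ`: for `‖a‖ ≤ r ≤ ρ`,
`‖(dd a b)ₙ‖ ρⁿ ≤ B/ρ`.
[cite: Robert2000PadicAnalysis, Ch. 6 §2 (zeros of power series; division by z − a)] -/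
theorem wtBdd_dd {ρ B r : ℝ} {b : ℕ → K} (hb : WtBdd ρ B b) (hρ : 0 < ρ) (hr : r ≤ ρ) {a : K}
    (ha : ‖a‖ ≤ r) : WtBdd ρ (B / ρ) (dd a b) := by
  intro n
  have h1 : ‖dd a b n‖ ≤ B / ρ ^ (n + 1) := by
    unfold dd
    exact (hb.shift hρ (n + 1)).norm_tsum_le hρ hr ha
  rw [show B / ρ = B / ρ ^ (n + 1) * ρ ^ n by rw [pow_succ]; field_simp]
  exact mul_le_mul_of_nonneg_right h1 (pow_nonneg hρ.le n)

omit [IsUltrametricDist K] in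
/-- The recursion behind synthetic division: `∑_k b_{n+k} aᵏ = bₙ + a · ∑_k b_{n+1+k} aᵏ`
(`‖a‖ ≤ r < ρ`).
[cite: Robert2000PadicAnalysis, Ch. 6 §2 (zeros of power series; division by z − a)] -/
theorem tsum_shift_eq {ρ B r : ℝ} {b : ℕ → K} (hb : WtBdd ρ B b) (hρ : 0 < ρ) (hr : r < ρ)
    {a : K} (ha : ‖a‖ ≤ r) (n : ℕ) :
    ∑' k, b (n + k) * a ^ k = b n + a * ∑' k, b (n + 1 + k) * a ^ k := by
  have hs : Summable fun k ↦ b (n + k) * a ^ k := (hb.shift hρ n).summable hρ hr ha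
  rw [hs.tsum_eq_zero_add, ← tsum_mul_left]
  congr 1
  · simp
  · refine tsum_congr fun k ↦ ?_
    rw [pow_succ, show n + (k + 1) = n + 1 + k by ring]
    ring

/-- **Division identity.** `G_b(z) = G_b(a) + (z − a) · G_{dd a b}(z)` for `‖z‖, ‖a‖ ≤ r < ρ`.
[cite: Robert2000PadicAnalysis, Ch. 6 §2 (zeros of power series; division by z − a)] -/
theorem tsum_eq_add_sub_mul_tsum_dd {ρ B r : ℝ} {b : ℕ → K} (hb : WtBdd ρ B b) (hρ : 0 < ρ)
    (hr : r < ρ) {a : K} (ha : ‖a‖ ≤ r) {z : K} (hz : ‖z‖ ≤ r) :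
    ∑' n, b n * z ^ n = (∑' n, b n * a ^ n) + (z - a) * ∑' n, dd a b n * z ^ n := by
  set h : ℕ → K := dd a b with hh
  have hhB : WtBdd ρ (B / ρ) h := wtBdd_dd hb hρ hr.le ha
  -- the recursion `b (n+1) = h n - a h (n+1)` and `b 0 = G(a) - a h 0`
  have hrec : ∀ n, b (n + 1) = h n - a * h (n + 1) := by
    intro n
    have := tsum_shift_eq hb hρ hr ha (n + 1)
    simp only [hh, dd]
    linear_combination -this
  have h0 : b 0 = (∑' n, b n * a ^ n) - a * h 0 := by
    have := tsum_shift_eq hb hρ hr ha 0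
    simp only [zero_add] at this
    simp only [hh, dd, zero_add]
    linear_combination -this
  have hsb : Summable fun n ↦ b n * z ^ n := hb.summable hρ hr hz
  have hsh : Summable fun n ↦ h n * z ^ n := hhB.summable hρ hr hz
  rw [hsb.tsum_eq_zero_add, hsh.tsum_eq_zero_add]
  simp only [pow_zero, mul_one]
  rw [h0]
  have h1 : ∑' n, b (n + 1) * z ^ (n + 1) =
      z * ∑' n, h n * z ^ n - a * ∑' n, h (n + 1) * z ^ (n + 1) := by
    rw [← tsum_mul_left, ← tsum_mul_left, ← (hsh.mul_left z).tsum_sub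
      (((summable_nat_add_iff 1).mpr hsh).mul_left a)]
    refine tsum_congr fun n ↦ ?_
    rw [hrec n]
    ring
  rw [h1, hsh.tsum_eq_zero_add]
  simp only [pow_zero, mul_one]
  ring

/-- Lipschitz estimate on the disc: `‖G_b(z) − G_b(a)‖ ≤ ‖z − a‖ · B/ρ`.
[cite: Robert2000PadicAnalysis, Ch. 6 §2 (zeros of power series; division by z − a)] -/
theorem norm_tsum_sub_tsum_le {ρ B r : ℝ} {b : ℕ → K} (hb : WtBdd ρ B b)
    (hρ : 0 < ρ) (hr : r < ρ) {a : K} (ha : ‖a‖ ≤ r) {z : K} (hz : ‖z‖ ≤ r) :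
    ‖(∑' n, b n * z ^ n) - ∑' n, b n * a ^ n‖ ≤ ‖z - a‖ * (B / ρ) := by
  rw [tsum_eq_add_sub_mul_tsum_dd hb hρ hr ha hz, add_sub_cancel_left, norm_mul]
  exact mul_le_mul_of_nonneg_left ((wtBdd_dd hb hρ hr.le ha).norm_tsum_le hρ hr.le hz) (norm_nonneg _)


/-! ### Commutation of divided differences -/

omit [IsUltrametricDist K] in
/-- Summability of the double family `b_{n+2+k+j} cʲ aᵏ` behind `dd a (dd c b)`.
[cite: Robert2000PadicAnalysis, Ch. 6 §2 (zeros of power series; division by z − a)] -/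
theorem summable_uncurry_dd {ρ B r : ℝ} {b : ℕ → K} (hb : WtBdd ρ B b) (hρ : 0 < ρ) (hr : r < ρ)
    {a c : K} (ha : ‖a‖ ≤ r) (hc : ‖c‖ ≤ r) (n : ℕ) :
    Summable (Function.uncurry fun k j : ℕ ↦ b (n + 1 + k + 1 + j) * c ^ j * a ^ k) := by
  have hr0 : 0 ≤ r := (norm_nonneg _).trans ha
  have hu0 : 0 ≤ r / ρ := div_nonneg hr0 hρ.le
  have hu1 : r / ρ < 1 := (div_lt_one hρ).mpr hr
  have hB := hb.nonneg
  have hgeo := summable_geometric_of_lt_one hu0 hu1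
  have hprod : Summable fun x : ℕ × ℕ ↦ (r / ρ) ^ x.1 * (r / ρ) ^ x.2 :=
    hgeo.mul_of_nonneg hgeo (fun _ ↦ pow_nonneg hu0 _) (fun _ ↦ pow_nonneg hu0 _)
  refine Summable.of_norm_bounded (hprod.mul_left (B / ρ ^ (n + 2))) ?_
  rintro ⟨k, j⟩
  simp only [Function.uncurry_apply_pair]
  have h1 := hb (n + 1 + k + 1 + j)
  have hρpow : 0 < ρ ^ (n + 1 + k + 1 + j) := pow_pos hρ _
  rw [norm_mul, norm_mul, norm_pow, norm_pow]
  have hbn : ‖b (n + 1 + k + 1 + j)‖ ≤ B / ρ ^ (n + 1 + k + 1 + j) := by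
    rw [le_div_iff₀ hρpow]; exact h1
  calc ‖b (n + 1 + k + 1 + j)‖ * ‖c‖ ^ j * ‖a‖ ^ k
      ≤ B / ρ ^ (n + 1 + k + 1 + j) * r ^ j * r ^ k := by
        have := div_nonneg hB hρpow.le
        gcongr
    _ = B / ρ ^ (n + 2) * ((r / ρ) ^ k * (r / ρ) ^ j) := by
        rw [show n + 1 + k + 1 + j = (n + 2) + (k + j) by ring, pow_add, div_pow, div_pow]
        field_simp
        ring

omit [IsUltrametricDist K] in
/-- **Divided differences commute**: `dd a (dd c b) = dd c (dd a b)` (both are the coefficient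
sequence of the second divided difference `G_b[a, c, ·]`).
[cite: Robert2000PadicAnalysis, Ch. 6 §2 (zeros of power series; division by z − a)] -/
theorem dd_comm {ρ B r : ℝ} {b : ℕ → K} (hb : WtBdd ρ B b) (hρ : 0 < ρ) (hr : r < ρ)
    {a c : K} (ha : ‖a‖ ≤ r) (hc : ‖c‖ ≤ r) : dd a (dd c b) = dd c (dd a b) := by
  funext n
  set F : ℕ → ℕ → K := fun k j ↦ b (n + 1 + k + 1 + j) * c ^ j * a ^ k with hF
  have hsum := summable_uncurry_dd hb hρ hr ha hc n
  -- each inner family is summable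
  have hk : ∀ k, Summable (F k) := by
    intro k
    have h := ((hb.shift hρ (n + 1 + k + 1)).summable hρ hr hc).mul_right (a ^ k)
    refine h.congr fun j ↦ ?_
    simp only [hF]
  have hj : ∀ j, Summable fun k ↦ F k j := by
    intro j
    have h := ((hb.shift hρ (n + 1 + j + 1)).summable hρ hr ha).mul_right (c ^ j)
    refine h.congr fun k ↦ ?_
    simp only [hF]
    rw [show n + 1 + j + 1 + k = n + 1 + k + 1 + j by ring]
    ring
  have lhs : dd a (dd c b) n = ∑' k, ∑' j, F k j := by
    simp only [dd, hF]
    refine tsum_congr fun k ↦ ?_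
    rw [← tsum_mul_right]
  have rhs : dd c (dd a b) n = ∑' j, ∑' k, F k j := by
    simp only [dd, hF]
    refine tsum_congr fun j ↦ ?_
    rw [← tsum_mul_right]
    refine tsum_congr fun k ↦ ?_
    rw [show n + 1 + j + 1 + k = n + 1 + k + 1 + j by ring]
    ring
  rw [lhs, rhs]
  exact (hsum.tsum_comm' hk hj).symm

/-! ### Iterated divided differences along a list of nodes -/

/-- Iterated divided differences along a list of nodes, applied in order (`x₀` first):
`ddList [x₀, x₁, …] b = ⋯ (dd x₁ (dd x₀ b))`. Repeated nodes are allowed.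
[cite: Yu1990, Lemma 1.2 (p-adic extrapolation for normal functions; Newton divided-difference form)] -/
def ddList (xs : List K) (b : ℕ → K) : ℕ → K :=
  xs.foldl (fun g x ↦ dd x g) b

omit [IsUltrametricDist K] [CompleteSpace K] in
/-- `ddList [] b = b`.
[cite: Yu1990, Lemma 1.2 (p-adic extrapolation for normal functions; Newton divided-difference form)] -/
@[simp] theorem ddList_nil (b : ℕ → K) : ddList [] b = b := rfl

omit [IsUltrametricDist K] [CompleteSpace K] in
/-- `ddList (x :: xs) b = ddList xs (dd x b)`.
[cite: Yu1990, Lemma 1.2 (p-adic extrapolation for normal functions; Newton divided-difference form)] -/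
@[simp] theorem ddList_cons (x : K) (xs : List K) (b : ℕ → K) :
    ddList (x :: xs) b = ddList xs (dd x b) := rfl

omit [IsUltrametricDist K] [CompleteSpace K] in
/-- `ddList (xs ++ [x]) b = dd x (ddList xs b)`.
[cite: Yu1990, Lemma 1.2 (p-adic extrapolation for normal functions; Newton divided-difference form)] -/
theorem ddList_append_singleton (xs : List K) (x : K) (b : ℕ → K) :
    ddList (xs ++ [x]) b = dd x (ddList xs b) := by
  simp [ddList, List.foldl_append]

omit [IsUltrametricDist K] [CompleteSpace K] in
/-- `ddList (replicate (k+1) a) b = dd a (ddList (replicate k a) b)`.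
[cite: Yu1990, Lemma 1.2 (p-adic extrapolation for normal functions; Newton divided-difference form)] -/
theorem ddList_replicate_succ (k : ℕ) (a : K) (b : ℕ → K) :
    ddList (List.replicate (k + 1) a) b = dd a (ddList (List.replicate k a) b) := by
  rw [List.replicate_succ', ddList_append_singleton]

omit [CompleteSpace K] in
/-- The weighted bound along a list of nodes in the disc `‖x‖ ≤ r ≤ ρ`: `ddList xs b` satisfies
it with `B / ρ^{|xs|}`.
[cite: Yu1990, Lemma 1.2 (p-adic extrapolation for normal functions; Newton divided-difference form)] -/
theorem wtBdd_ddList {ρ B r : ℝ} (hρ : 0 < ρ) (hr : r ≤ ρ) :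
    ∀ (xs : List K) {b : ℕ → K}, WtBdd ρ B b → (∀ x ∈ xs, ‖x‖ ≤ r) →
      WtBdd ρ (B / ρ ^ xs.length) (ddList xs b) := by
  intro xs
  induction xs generalizing B with
  | nil => intro b hb _; simpa using hb
  | cons x xs ih =>
    intro b hb hxs
    have hx : ‖x‖ ≤ r := hxs x (by simp)
    have h1 : WtBdd ρ (B / ρ) (dd x b) := wtBdd_dd hb hρ hr hx
    have h2 := ih h1 (fun y hy ↦ hxs y (by simp [hy]))
    rw [ddList_cons, List.length_cons, pow_succ', ← div_div]
    exact h2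

/-- Permutation invariance: the order of the nodes does not matter (`dd_comm`).
[cite: Yu1990, Lemma 1.2 (p-adic extrapolation for normal functions; Newton divided-difference form)] -/
theorem ddList_perm {ρ B r : ℝ} (hρ : 0 < ρ) (hr : r < ρ) {xs ys : List K} (hp : xs.Perm ys)
    {b : ℕ → K} (hb : WtBdd ρ B b) (hxs : ∀ x ∈ xs, ‖x‖ ≤ r) : ddList xs b = ddList ys b := by
  induction hp generalizing B b with
  | nil => rfl
  | cons x _ ih =>
    simp only [ddList_cons]
    exact ih (wtBdd_dd hb hρ hr.le (hxs x (by simp))) (fun y hy ↦ hxs y (by simp [hy]))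
  | swap x y l =>
    simp only [ddList_cons]
    rw [dd_comm hb hρ hr (hxs x (by simp)) (hxs y (by simp))]
  | trans h₁ _ ih₁ ih₂ =>
    rw [ih₁ hb hxs, ih₂ hb (fun y hy ↦ hxs y (h₁.mem_iff.mpr hy))]

/-! ### Newton's formula with remainder -/

/-- The Newton sum `∑ᵢ G_{b⁽ⁱ⁾}(xᵢ) ∏_{j<i} (z − xⱼ)`, `b⁽ⁱ⁾ = ddList [x₀,…,x_{i−1}] b`, defined by
the recursion `N([], b) = 0`, `N(x :: xs, b) = G_b(x) + (z − x) · N(xs, dd x b)`.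
[cite: Yu1990, Lemma 1.2 (p-adic extrapolation for normal functions; Newton divided-difference form)] -/
def newtonSum : List K → (ℕ → K) → K → K
  | [], _, _ => 0
  | x :: xs, b, z => (∑' n, b n * x ^ n) + (z - x) * newtonSum xs (dd x b) z

omit [IsUltrametricDist K] [CompleteSpace K] in
/-- Unfolding `newtonSum` on `x :: xs`.
[cite: Yu1990, Lemma 1.2 (p-adic extrapolation for normal functions; Newton divided-difference form)] -/
@[simp] theorem newtonSum_cons (x : K) (xs : List K) (b : ℕ → K) (z : K) :
    newtonSum (x :: xs) b z = (∑' n, b n * x ^ n) + (z - x) * newtonSum xs (dd x b) z := rfl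

omit [IsUltrametricDist K] [CompleteSpace K] in
/-- `newtonSum [] b z = 0`.
[cite: Yu1990, Lemma 1.2 (p-adic extrapolation for normal functions; Newton divided-difference form)] -/
@[simp] theorem newtonSum_nil (b : ℕ → K) (z : K) : newtonSum [] b z = 0 := rfl

/-- **Newton's interpolation formula with remainder** (confluent nodes allowed):
`G_b(z) = newtonSum xs b z + (∏_{x ∈ xs} (z − x)) · G_{ddList xs b}(z)` for all nodes and `z` in the
disc `‖·‖ ≤ r < ρ`.
[cite: Yu1990, Lemma 1.2 (p-adic extrapolation for normal functions; Newton divided-difference form)] -/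
theorem tsum_eq_newtonSum_add {ρ B r : ℝ} (hρ : 0 < ρ) (hr : r < ρ) :
    ∀ (xs : List K) {b : ℕ → K}, WtBdd ρ B b → (∀ x ∈ xs, ‖x‖ ≤ r) → ∀ {z : K}, ‖z‖ ≤ r →
      ∑' n, b n * z ^ n =
        newtonSum xs b z + (xs.map fun x ↦ z - x).prod * ∑' n, ddList xs b n * z ^ n := by
  intro xs
  induction xs generalizing B with
  | nil => intro b _ _ z _; simp
  | cons x xs ih =>
    intro b hb hxs z hz
    have hx : ‖x‖ ≤ r := hxs x (by simp)
    have h1 := tsum_eq_add_sub_mul_tsum_dd hb hρ hr hx hz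
    have h2 := ih (wtBdd_dd hb hρ hr.le hx) (fun y hy ↦ hxs y (by simp [hy])) hz
    rw [h1, h2, newtonSum_cons, ddList_cons, List.map_cons, List.prod_cons]
    ring


end PadicNewton

end Literature.NumberTheory.Transcendental

end
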